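import Literature.NumberTheory.Automorphic.GL2CUnitaryKTypes
import HarnessLib

/-!
# The Eichler–Shimura–Harder `1`-cochain of `GL₂(ℂ)` in the six-operator language:
# Kuga's setup for `(𝔰𝔩₂(ℂ), SU(2))` from two commuting operator families, and the cochain of a
# `𝔨`-highest-weight vector of weight `2`

Algebra only (no analysis, no automorphic forms).  A real `𝔤𝔩₂(ℂ)`-module is encoded by six
operators `O = (L(E), L(F), L(H), R(E), R(F), R(H))` (`GL2CKType.Ops`, two commuting
`𝔰𝔩₂`-triples, `ρ(X) = L(X) + R(X̄)`).  For the tensor product `H = C ⊗ V` of an automorphic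
factor (operators `O₁`) and a coefficient factor (operators `O₂`) — two COMMUTING lawful families on
one space — this file builds:

* `Ops.add O₁ O₂` (the diagonal action), lawful when the families commute (`isLawful_add`);
* the un-normalised orthogonal bases `x = (H, E+F, i(E−F))` of `𝔭₀` and `y = (iH, E−F, i(E+F))` of
  `𝔰𝔲(2)` read through a lawful `O`: `pVec O = (P₀, P₊+P₋, i(P₊−P₋))`,
  `kVec O = (iH_k, E_k−F_k, i(E_k+F_k))`, the structure constants `aTab` of `[y_α, x_i]`, the bracket
  relations (`pVec_bracket`) and `∑ x_i² − ∑ y_α² = 4(Ω_L + Ω_R)` (`pVec_sq_sub_kVec_sq`);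
* **Kuga's setup** `setup O₁ O₂ : Kuga.Setup H (Fin 3) (Fin 3)` (`π` from `O₁`, `ρ` from `O₂`) and
  its lawfulness `isLawful_setup` under `Ω_L + Ω_R` acting by the same scalar in both factors
  (the infinitesimal character condition) [cite: BorelWallach2000, II §2.3–2.5];
* **the cochain of a highest-weight vector**: for `y ∈ H` with `E_k y = 0`, `H_k y = 2y`,
  `F_k³ y = 0` (diagonal `𝔨`), `eshCochain O y = (−F_k y, y − ½F_k²y, i(y + ½F_k²y))` is a
  `1`-cochain of the relative complex (`isCochain_eshCochain`: `𝔨`-equivariance `𝔭₀ → H`)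
  [cite: Harder1987, §3.1 (3.1.3)–(3.1.5)];
* with a positive form for which `O₁` is of unitary type (`L(Z)† = −R(Z̄)`, Petersson) and `O₂`
  of compact type (`L(E)† = L(F)`, `L(H)† = L(H)`, same for `R`: an admissible inner product),
  Kuga's lemma gives **closedness and co-closedness** of the cochain (`eshCochain_closed`,
  `eshCochain_coclosed`) [cite: BorelWallach2000, II Prop. 2.5] [cite: MatsushimaMurakami1963, §4–§6].

No named fact; definitions `Ops.add`, `pVec`, `kVec`, `aTab`, `setup`, `eshCochain`.
-/

noncomputable section

open Finset Complex
open scoped BigOperators ComplexConjugate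

namespace Literature.NumberTheory.Automorphic

namespace GL2CKType

/-- `i · a · i = −a`. [folklore] -/
theorem I_mul_mul_I (a : ℂ) : I * a * I = -a := by
  rw [mul_comm I a, mul_assoc, I_mul_I, mul_neg_one]
/-- `i · (a · i) = −a`. [folklore] -/
theorem I_mul_mul_I' (a : ℂ) : I * (a * I) = -a := by rw [← mul_assoc, I_mul_mul_I]
/-- `i · (i · a) = −a`. [folklore] -/
theorem I_mul_I_mul (a : ℂ) : I * (I * a) = -a := by rw [← mul_assoc, I_mul_I, neg_one_mul]
/-- `a · i · i = −a`. [folklore] -/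
theorem mul_I_mul_I (a : ℂ) : a * I * I = -a := by rw [mul_assoc, I_mul_I, mul_neg_one]
/-- `i · (a · (i · b)) = −(a · b)`. [folklore] -/
theorem I_mul_mul_I_mul (a b : ℂ) : I * (a * (I * b)) = -(a * b) := by
  rw [← mul_assoc a, mul_comm a I, mul_assoc I a, I_mul_I_mul]

namespace Ops

variable {M : Type*} [AddCommGroup M] [Module ℂ M]

/-! ### Sums of commuting operator families -/

/-- The diagonal family `O₁ + O₂` (on `C ⊗ V`: `L(E) = L₁(E) ⊗ 1 + 1 ⊗ L₂(E)`, …). [folklore] -/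
def add (O₁ O₂ : Ops M) : Ops M where
  LE := O₁.LE + O₂.LE
  LF := O₁.LF + O₂.LF
  LH := O₁.LH + O₂.LH
  RE := O₁.RE + O₂.RE
  RF := O₁.RF + O₂.RF
  RH := O₁.RH + O₂.RH

/-- The six operators as a list. [folklore] -/
def toList (O : Ops M) : List (Module.End ℂ M) := [O.LE, O.LF, O.LH, O.RE, O.RF, O.RH]

/-- Two families commute: every operator of the first commutes with every operator of the second.
[folklore] -/
def CommutesWith (O₁ O₂ : Ops M) : Prop :=
  ∀ A ∈ O₁.toList, ∀ B ∈ O₂.toList, ∀ v : M, A (B v) = B (A v)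

section Add

variable {O₁ O₂ : Ops M}

/-- Unfolding. [folklore] -/
@[simp] theorem add_LE (v : M) : (O₁.add O₂).LE v = O₁.LE v + O₂.LE v := rfl
/-- Unfolding. [folklore] -/
@[simp] theorem add_LF (v : M) : (O₁.add O₂).LF v = O₁.LF v + O₂.LF v := rfl
/-- Unfolding. [folklore] -/
@[simp] theorem add_LH (v : M) : (O₁.add O₂).LH v = O₁.LH v + O₂.LH v := rfl
/-- Unfolding. [folklore] -/
@[simp] theorem add_RE (v : M) : (O₁.add O₂).RE v = O₁.RE v + O₂.RE v := rfl
/-- Unfolding. [folklore] -/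
@[simp] theorem add_RF (v : M) : (O₁.add O₂).RF v = O₁.RF v + O₂.RF v := rfl
/-- Unfolding. [folklore] -/
@[simp] theorem add_RH (v : M) : (O₁.add O₂).RH v = O₁.RH v + O₂.RH v := rfl

/-- Membership in `toList`. [folklore] -/
theorem mem_toList (O : Ops M) (A : Module.End ℂ M) :
    A ∈ O.toList ↔ A = O.LE ∨ A = O.LF ∨ A = O.LH ∨ A = O.RE ∨ A = O.RF ∨ A = O.RH := by
  simp [toList]

/-- **The sum of two commuting lawful families is lawful.** [folklore] -/
theorem isLawful_add (h₁ : O₁.IsLawful) (h₂ : O₂.IsLawful) (hc : O₁.CommutesWith O₂) :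
    (O₁.add O₂).IsLawful := by
  have c : ∀ A, (A = O₁.LE ∨ A = O₁.LF ∨ A = O₁.LH ∨ A = O₁.RE ∨ A = O₁.RF ∨ A = O₁.RH) →
      ∀ B, (B = O₂.LE ∨ B = O₂.LF ∨ B = O₂.LH ∨ B = O₂.RE ∨ B = O₂.RF ∨ B = O₂.RH) →
      ∀ v, A (B v) = B (A v) := fun A hA B hB =>
    hc A ((mem_toList O₁ A).2 hA) B ((mem_toList O₂ B).2 hB)
  have t : ∀ {P : Prop}, P ∨ ¬P := Classical.em _
  refine ⟨fun v => ?_, fun v => ?_, fun v => ?_, fun v => ?_, fun v => ?_, fun v => ?_, fun v => ?_,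
    fun v => ?_, fun v => ?_, fun v => ?_, fun v => ?_, fun v => ?_, fun v => ?_, fun v => ?_,
    fun v => ?_⟩ <;>
  simp only [add_LE, add_LF, add_LH, add_RE, add_RF, add_RH, map_add, smul_add, h₁.lhe, h₁.lhf,
    h₁.lef, h₁.rhe, h₁.rhf, h₁.ref, h₁.cEE, h₁.cEF, h₁.cEH, h₁.cFE, h₁.cFF, h₁.cFH, h₁.cHE,
    h₁.cHF, h₁.cHH, h₂.lhe, h₂.lhf, h₂.lef, h₂.rhe, h₂.rhf, h₂.ref, h₂.cEE, h₂.cEF, h₂.cEH,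
    h₂.cFE, h₂.cFF, h₂.cFH, h₂.cHE, h₂.cHF, h₂.cHH, c O₁.LE (by simp) O₂.LF (by simp),
    c O₁.LE (by simp) O₂.LH (by simp), c O₁.LE (by simp) O₂.RE (by simp),
    c O₁.LE (by simp) O₂.RF (by simp), c O₁.LE (by simp) O₂.RH (by simp),
    c O₁.LF (by simp) O₂.LE (by simp), c O₁.LF (by simp) O₂.LH (by simp),
    c O₁.LF (by simp) O₂.RE (by simp), c O₁.LF (by simp) O₂.RF (by simp),
    c O₁.LF (by simp) O₂.RH (by simp), c O₁.LH (by simp) O₂.LE (by simp),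
    c O₁.LH (by simp) O₂.LF (by simp), c O₁.LH (by simp) O₂.RE (by simp),
    c O₁.LH (by simp) O₂.RF (by simp), c O₁.LH (by simp) O₂.RH (by simp),
    c O₁.RE (by simp) O₂.LE (by simp), c O₁.RE (by simp) O₂.LF (by simp),
    c O₁.RE (by simp) O₂.LH (by simp), c O₁.RE (by simp) O₂.RF (by simp),
    c O₁.RE (by simp) O₂.RH (by simp), c O₁.RF (by simp) O₂.LE (by simp),
    c O₁.RF (by simp) O₂.LF (by simp), c O₁.RF (by simp) O₂.LH (by simp),
    c O₁.RF (by simp) O₂.RE (by simp), c O₁.RF (by simp) O₂.RH (by simp),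
    c O₁.RH (by simp) O₂.LE (by simp), c O₁.RH (by simp) O₂.LF (by simp),
    c O₁.RH (by simp) O₂.LH (by simp), c O₁.RH (by simp) O₂.RE (by simp),
    c O₁.RH (by simp) O₂.RF (by simp)] <;>
  module

end Add

end Ops

/-! ### The bases of `𝔭₀` and `𝔰𝔲(2)` through a lawful family -/

namespace Ops

variable {M : Type*} [AddCommGroup M] [Module ℂ M] (O : Ops M)

/-- `x = (H, E+F, i(E−F)) ↦ (P₀, P₊+P₋, i(P₊−P₋))`: the (un-normalised, pairwise orthogonal, all of
square-norm `2` for `Re tr`) basis of `𝔭₀` acting through `ρ(X) = L(X) + R(X̄)`. [cite: Knapp2002, §VI.1] -/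
def pVec : Fin 3 → Module.End ℂ M := ![O.P0, O.Pp + O.Pm, I • (O.Pp - O.Pm)]

/-- `y = (iH, E−F, i(E+F)) ↦ (iH_k, E_k−F_k, i(E_k+F_k))`: the basis of `𝔰𝔲(2)` (square-norm `2`
for `−Re tr`). [cite: Knapp2002, §VI.1] -/
def kVec : Fin 3 → Module.End ℂ M := ![I • O.Hk, O.Ek - O.Fk, I • (O.Ek + O.Fk)]

/-- Unfolding. [folklore] -/
@[simp] theorem pVec_zero (v : M) : O.pVec 0 v = O.P0 v := rfl
/-- Unfolding. [folklore] -/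
@[simp] theorem pVec_one (v : M) : O.pVec 1 v = O.Pp v + O.Pm v := rfl
/-- Unfolding. [folklore] -/
@[simp] theorem pVec_two (v : M) : O.pVec 2 v = I • (O.Pp v - O.Pm v) := rfl
/-- Unfolding. [folklore] -/
@[simp] theorem kVec_zero (v : M) : O.kVec 0 v = I • O.Hk v := rfl
/-- Unfolding. [folklore] -/
@[simp] theorem kVec_one (v : M) : O.kVec 1 v = O.Ek v - O.Fk v := rfl
/-- Unfolding. [folklore] -/
@[simp] theorem kVec_two (v : M) : O.kVec 2 v = I • (O.Ek v + O.Fk v) := rfl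

end Ops

/-- The structure constants `[y_α, x_i] = ∑_j aTab α i j • x_j` of `𝔰𝔲(2)` on `𝔭₀` in the bases
`x = (H, E+F, i(E−F))`, `y = (iH, E−F, i(E+F))`: `[iH, E+F] = 2 i(E−F)`, `[iH, i(E−F)] = −2(E+F)`,
`[E−F, H] = −2(E+F)`, `[E−F, E+F] = 2H`, `[i(E+F), H] = −2i(E−F)`, `[i(E+F), i(E−F)] = 2H`.
[cite: Knapp2002, §VI.1] -/
def aTab : Fin 3 → Fin 3 → Fin 3 → ℂ :=
  ![![![0, 0, 0], ![0, 0, 2], ![0, -2, 0]],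
    ![![0, -2, 0], ![2, 0, 0], ![0, 0, 0]],
    ![![0, 0, -2], ![0, 0, 0], ![2, 0, 0]]]

/-- `aTab` is antisymmetric in the two `𝔭`-indices (invariance of the trace form). [folklore] -/
theorem aTab_antisymm (α i j : Fin 3) : aTab α i j = -aTab α j i := by
  fin_cases α <;> fin_cases i <;> fin_cases j <;> simp [aTab]

namespace Ops

variable {M : Type*} [AddCommGroup M] [Module ℂ M] {O : Ops M} (hO : O.IsLawful)
include hO

/-- `[P₀, P₋] = −2F_k`. [folklore] -/
theorem P0_Pm (v : M) : O.P0 (O.Pm v) = O.Pm (O.P0 v) - (2 : ℂ) • O.Fk v := by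
  simp only [P0_apply, Pm_apply, Fk_apply, map_add, smul_sub, hO.lhf, hO.rhe, hO.cEH, hO.cHF]
  module

/-- **The bracket relations of `𝔭₀` through a lawful family**:
`[x_i, x_j] = −∑_α aTab α i j • y_α`. [cite: Knapp2002, §VI.1] -/
theorem pVec_bracket (i j : Fin 3) (v : M) :
    O.pVec i (O.pVec j v) - O.pVec j (O.pVec i v) = -∑ α, aTab α i j • O.kVec α v := by
  fin_cases i <;> fin_cases j <;>
  simp only [Fin.zero_eta, Fin.mk_one, Fin.reduceFinMk, Fin.isValue, pVec_zero, pVec_one, pVec_two,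
    kVec_zero, kVec_one, kVec_two, Fin.sum_univ_three, aTab, Matrix.cons_val_zero,
    Matrix.cons_val_one, Matrix.cons_val_two, Matrix.head_cons, Matrix.tail_cons, P0_apply,
    Pp_apply, Pm_apply, Ek_apply, Fk_apply, Hk_apply, map_add, map_sub, map_smul, smul_add,
    smul_sub, smul_smul, zero_smul, neg_smul, I_mul_I, hO.lhe, hO.lhf, hO.lef, hO.rhe, hO.rhf,
    hO.ref, hO.cEE, hO.cEF, hO.cEH, hO.cFE, hO.cFF, hO.cFH, hO.cHE, hO.cHF, hO.cHH] <;>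
  module

/-- **`∑_i x_i² − ∑_α y_α² = 4(Ω_L + Ω_R)`** through a lawful family (the real Casimir of
`𝔰𝔩₂(ℂ)` for `½ Re tr`): `P₀² + (P₊+P₋)² − (P₊−P₋)² + H_k² − (E_k−F_k)² + (E_k+F_k)²
= 2(½P₀² + P₊P₋ + P₋P₊ + ½H_k² + E_kF_k + F_kE_k)`. [cite: Knapp2002, (5.24) and §VI.1] -/
theorem pVec_sq_sub_kVec_sq (v : M) :
    ∑ i, O.pVec i (O.pVec i v) - ∑ α, O.kVec α (O.kVec α v) = (4 : ℂ) • (O.casL v + O.casR v) := by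
  have hp := pCasimir_eq hO v
  have hp' : (4 : ℂ) • (O.casL v + O.casR v) = (2 : ℂ) • ((2 : ℂ)⁻¹ • O.P0 (O.P0 v) +
      O.Pp (O.Pm v) + O.Pm (O.Pp v)) +
      (2 : ℂ) • ((2 : ℂ)⁻¹ • O.Hk (O.Hk v) + O.Ek (O.Fk v) + O.Fk (O.Ek v)) := by
    rw [hp]; module
  rw [hp']
  simp only [Fin.sum_univ_three, pVec_zero, pVec_one, pVec_two, kVec_zero, kVec_one, kVec_two,
    map_add, map_sub, map_smul, smul_sub, smul_add, smul_smul, I_mul_I]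
  module

end Ops

/-! ### Kuga's setup from two commuting families -/

section Setup

variable {M : Type*} [AddCommGroup M] [Module ℂ M] (O₁ O₂ : Ops M)

/-- **Kuga's setup for `(𝔰𝔩₂(ℂ), SU(2))` on `H = C ⊗ V`**: `π(x_i), π(y_α)` from the automorphic
family `O₁`, `ρ(x_i), ρ(y_α)` from the coefficient family `O₂`, structure constants `aTab`.
[cite: BorelWallach2000, II §2.1–2.3] -/
def setup : Kuga.Setup M (Fin 3) (Fin 3) where
  πp := O₁.pVec
  πk := O₁.kVec
  ρp := O₂.pVec
  ρk := O₂.kVec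
  a := aTab

variable {O₁ O₂}

/-- Every `pVec`/`kVec` operator of `O₁` commutes with every one of `O₂` when the families commute.
[folklore] -/
theorem pVec_kVec_comm (hc : O₁.CommutesWith O₂) :
    (∀ (i j : Fin 3) (v : M), O₁.pVec i (O₂.pVec j v) = O₂.pVec j (O₁.pVec i v)) ∧
    (∀ (i j : Fin 3) (v : M), O₁.kVec i (O₂.kVec j v) = O₂.kVec j (O₁.kVec i v)) := by
  have c : ∀ A, (A = O₁.LE ∨ A = O₁.LF ∨ A = O₁.LH ∨ A = O₁.RE ∨ A = O₁.RF ∨ A = O₁.RH) →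
      ∀ B, (B = O₂.LE ∨ B = O₂.LF ∨ B = O₂.LH ∨ B = O₂.RE ∨ B = O₂.RF ∨ B = O₂.RH) →
      ∀ v, A (B v) = B (A v) := fun A hA B hB =>
    hc A ((Ops.mem_toList O₁ A).2 hA) B ((Ops.mem_toList O₂ B).2 hB)
  constructor <;> intro i j v <;> fin_cases i <;> fin_cases j <;>
  simp only [Ops.pVec_zero, Ops.pVec_one, Ops.pVec_two, Ops.kVec_zero, Ops.kVec_one, Ops.kVec_two,
    Ops.P0_apply, Ops.Pp_apply, Ops.Pm_apply, Ops.Ek_apply, Ops.Fk_apply, Ops.Hk_apply, map_add,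
    map_sub, map_smul, smul_add, smul_sub, Fin.zero_eta, Fin.mk_one, Fin.reduceFinMk,
    c O₁.LE (by simp) O₂.LE (by simp), c O₁.LE (by simp) O₂.LF (by simp),
    c O₁.LE (by simp) O₂.LH (by simp), c O₁.LE (by simp) O₂.RE (by simp),
    c O₁.LE (by simp) O₂.RF (by simp), c O₁.LE (by simp) O₂.RH (by simp),
    c O₁.LF (by simp) O₂.LE (by simp), c O₁.LF (by simp) O₂.LF (by simp),
    c O₁.LF (by simp) O₂.LH (by simp), c O₁.LF (by simp) O₂.RE (by simp),
    c O₁.LF (by simp) O₂.RF (by simp), c O₁.LF (by simp) O₂.RH (by simp),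
    c O₁.LH (by simp) O₂.LE (by simp), c O₁.LH (by simp) O₂.LF (by simp),
    c O₁.LH (by simp) O₂.LH (by simp), c O₁.LH (by simp) O₂.RE (by simp),
    c O₁.LH (by simp) O₂.RF (by simp), c O₁.LH (by simp) O₂.RH (by simp),
    c O₁.RE (by simp) O₂.LE (by simp), c O₁.RE (by simp) O₂.LF (by simp),
    c O₁.RE (by simp) O₂.LH (by simp), c O₁.RE (by simp) O₂.RE (by simp),
    c O₁.RE (by simp) O₂.RF (by simp), c O₁.RE (by simp) O₂.RH (by simp),
    c O₁.RF (by simp) O₂.LE (by simp), c O₁.RF (by simp) O₂.LF (by simp),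
    c O₁.RF (by simp) O₂.LH (by simp), c O₁.RF (by simp) O₂.RE (by simp),
    c O₁.RF (by simp) O₂.RF (by simp), c O₁.RF (by simp) O₂.RH (by simp),
    c O₁.RH (by simp) O₂.LE (by simp), c O₁.RH (by simp) O₂.LF (by simp),
    c O₁.RH (by simp) O₂.LH (by simp), c O₁.RH (by simp) O₂.RE (by simp),
    c O₁.RH (by simp) O₂.RF (by simp), c O₁.RH (by simp) O₂.RH (by simp)] <;>
  module

/-- **Kuga's setup is lawful** when both families are lawful, commute, and `Ω_L + Ω_R` acts by the
same operator in both (on `C ⊗ V`: the infinitesimal character of the automorphic factor is that of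
the dual of the coefficients). [cite: BorelWallach2000, II §2.3 and Prop. 2.5] -/
theorem isLawful_setup (h₁ : O₁.IsLawful) (h₂ : O₂.IsLawful) (hc : O₁.CommutesWith O₂)
    (hcas : ∀ v, O₁.casL v + O₁.casR v = O₂.casL v + O₂.casR v) : (setup O₁ O₂).IsLawful where
  antisymm := aTab_antisymm
  bracket_π i j v := Ops.pVec_bracket h₁ i j v
  bracket_ρ i j v := Ops.pVec_bracket h₂ i j v
  comm_pp i j v := (pVec_kVec_comm hc).1 i j v
  comm_kk i j v := (pVec_kVec_comm hc).2 i j v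
  casimir v := by
    change ∑ i, O₁.pVec i (O₁.pVec i v) - ∑ α, O₁.kVec α (O₁.kVec α v) =
      ∑ i, O₂.pVec i (O₂.pVec i v) - ∑ α, O₂.kVec α (O₂.kVec α v)
    rw [Ops.pVec_sq_sub_kVec_sq h₁, Ops.pVec_sq_sub_kVec_sq h₂, hcas]

end Setup

/-! ### The cochain of a `𝔨`-highest-weight vector of weight `2` -/

section Cochain

variable {M : Type*} [AddCommGroup M] [Module ℂ M] (O : Ops M)

/-- **The Eichler–Shimura–Harder cochain** of a diagonal-`𝔨`-highest-weight vector `y` of weight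
`2`: the `𝔨`-equivariant map `𝔭₀,ℂ = 𝔰𝔩₂(ℂ) → H` with `E ↦ y` is `H ↦ −F_k y`, `F ↦ −½ F_k² y`
(`ad_F E = −H`, `ad_F H = 2F`), read on the real basis `(H, E+F, i(E−F))`:
`η = (−F_k y, y − ½F_k² y, i(y + ½F_k² y))`. [cite: Harder1987, §3.1 (3.1.3)–(3.1.5)] -/
def eshCochain (y : M) : Fin 3 → M :=
  ![-O.Fk y, y - (2 : ℂ)⁻¹ • O.Fk (O.Fk y), I • (y + (2 : ℂ)⁻¹ • O.Fk (O.Fk y))]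

/-- Unfolding. [folklore] -/
@[simp] theorem eshCochain_zero (y : M) : eshCochain O y 0 = -O.Fk y := rfl
/-- Unfolding. [folklore] -/
@[simp] theorem eshCochain_one (y : M) : eshCochain O y 1 = y - (2 : ℂ)⁻¹ • O.Fk (O.Fk y) := rfl
/-- Unfolding. [folklore] -/
@[simp] theorem eshCochain_two (y : M) :
    eshCochain O y 2 = I • (y + (2 : ℂ)⁻¹ • O.Fk (O.Fk y)) := rfl

variable {O} (hO : O.IsLawful)
include hO

/-- The `𝔨`-string of `y`: `E_k F_k y = 2y`, `E_k F_k² y = 2 F_k y`, `H_k F_k y = 0`,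
`H_k F_k² y = −2 F_k² y` for `E_k y = 0`, `H_k y = 2y`. [folklore] -/
theorem string_identities {y : M} (hE : O.Ek y = 0) (hH : O.Hk y = (2 : ℂ) • y) :
    O.Ek (O.Fk y) = (2 : ℂ) • y ∧ O.Ek (O.Fk (O.Fk y)) = (2 : ℂ) • O.Fk y ∧
      O.Hk (O.Fk y) = 0 ∧ O.Hk (O.Fk (O.Fk y)) = -((2 : ℂ) • O.Fk (O.Fk y)) := by
  have h1 : O.Ek (O.Fk y) = (2 : ℂ) • y := by rw [Ops.Ek_Fk hO, hE, map_zero, zero_add, hH]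
  have h3 : O.Hk (O.Fk y) = 0 := by rw [Ops.Hk_Fk hO, hH, map_smul]; module
  refine ⟨h1, ?_, h3, ?_⟩
  · rw [Ops.Ek_Fk hO, h1, map_smul, h3, add_zero]
  · rw [Ops.Hk_Fk hO, h3, map_zero, zero_sub]

/-- **The cochain of a highest-weight vector of weight `2` is a `1`-cochain** of the relative complex
for the DIAGONAL `𝔨` (`(π + ρ)(y_α) η(x_i) = ∑_j a_{α i j} η(x_j)`), provided `F_k³ y = 0` (`y`
generates the `3`-dimensional `𝔨`-type `𝔭₀,ℂ`). Here `O = O₁ + O₂`. [cite: Harder1987, §3.1] -/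
theorem isCochain_eshCochain {O₁ O₂ : Ops M} (hO₁₂ : O = O₁.add O₂) {y : M} (hE : O.Ek y = 0)
    (hH : O.Hk y = (2 : ℂ) • y) (hF3 : O.Fk (O.Fk (O.Fk y)) = 0) :
    (setup O₁ O₂).IsCochain (eshCochain O y) := by
  obtain ⟨s1, s2, s3, s4⟩ := string_identities hO hE hH
  have hk : ∀ α v, (setup O₁ O₂).πk α v + (setup O₁ O₂).ρk α v = O.kVec α v := by
    intro α v
    subst hO₁₂
    fin_cases α <;> simp [setup, Ops.add] <;> module
  intro α i
  rw [hk]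
  fin_cases α <;> fin_cases i <;>
  simp only [Ops.kVec_zero, Ops.kVec_one, Ops.kVec_two, eshCochain_zero, eshCochain_one,
    eshCochain_two, setup, Fin.sum_univ_three, aTab, map_neg, map_sub, map_add, map_smul, hE, hH,
    hF3, s1, s2, s3, s4, Matrix.cons_val_zero, Matrix.cons_val_one, Matrix.cons_val_two,
    Matrix.head_cons, Matrix.tail_cons, Fin.zero_eta, Fin.mk_one, Fin.reduceFinMk, smul_add,
    smul_sub, smul_neg, smul_zero, smul_smul, mul_assoc, I_mul_I, I_mul_I_mul, I_mul_mul_I_mul,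
    zero_smul, neg_zero, add_zero, zero_add, sub_zero, neg_smul, neg_neg, one_smul] <;>
  module

end Cochain

/-! ### Kuga's lemma for the cochain: closed and co-closed -/

section Kuga

variable {M : Type*} [AddCommGroup M] [Module ℂ M] {O₁ O₂ : Ops M} {ip : M → M → ℂ}

/-- `π(x_i)` is skew and `ρ(x_i)` is symmetric for a positive form making `O₁` of unitary type
(`⟨L₁(E) x, y⟩ = −⟨x, R₁(E) y⟩`, …: the Petersson form) and `O₂` of compact type
(`⟨L₂(E) x, y⟩ = ⟨x, L₂(F) y⟩`, `⟨L₂(H) x, y⟩ = ⟨x, L₂(H) y⟩`, same for `R₂`: an admissible inner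
product on the coefficients). [cite: BorelWallach2000, II §2.2] -/
theorem skew_and_symm (hip : Kuga.IsPosForm ip)
    (hE₁ : ∀ x y, ip (O₁.LE x) y = -ip x (O₁.RE y)) (hF₁ : ∀ x y, ip (O₁.LF x) y = -ip x (O₁.RF y))
    (hH₁ : ∀ x y, ip (O₁.LH x) y = -ip x (O₁.RH y))
    (hLE₂ : ∀ x y, ip (O₂.LE x) y = ip x (O₂.LF y)) (hLH₂ : ∀ x y, ip (O₂.LH x) y = ip x (O₂.LH y))
    (hRE₂ : ∀ x y, ip (O₂.RE x) y = ip x (O₂.RF y)) (hRH₂ : ∀ x y, ip (O₂.RH x) y = ip x (O₂.RH y)) :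
    (∀ (i : Fin 3) (x y : M), ip ((setup O₁ O₂).πp i x) y = -ip x ((setup O₁ O₂).πp i y)) ∧
    (∀ (i : Fin 3) (x y : M), ip ((setup O₁ O₂).ρp i x) y = ip x ((setup O₁ O₂).ρp i y)) := by
  -- the reverse relations by conjugate symmetry
  have flipNeg : ∀ {A B : Module.End ℂ M}, (∀ x y, ip (A x) y = -ip x (B y)) →
      ∀ x y, ip (B x) y = -ip x (A y) := fun {A B} h x y => by
    have e : ip y (B x) = -ip (A y) x := by rw [h y x, neg_neg]
    rw [← hip.conj_symm, e, map_neg, hip.conj_symm]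
  have flip : ∀ {A B : Module.End ℂ M}, (∀ x y, ip (A x) y = ip x (B y)) →
      ∀ x y, ip (B x) y = ip x (A y) := fun {A B} h x y => by
    rw [← hip.conj_symm, ← h y x, hip.conj_symm]
  have hRE₁ : ∀ x y, ip (O₁.RE x) y = -ip x (O₁.LE y) := flipNeg hE₁
  have hRF₁ : ∀ x y, ip (O₁.RF x) y = -ip x (O₁.LF y) := flipNeg hF₁
  have hRH₁ : ∀ x y, ip (O₁.RH x) y = -ip x (O₁.LH y) := flipNeg hH₁
  have hLF₂ : ∀ x y, ip (O₂.LF x) y = ip x (O₂.LE y) := flip hLE₂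
  have hRF₂ : ∀ x y, ip (O₂.RF x) y = ip x (O₂.RE y) := flip hRE₂
  constructor
  · intro i x y
    fin_cases i
    · show ip (O₁.P0 x) y = -ip x (O₁.P0 y)
      simp only [Ops.P0_apply, hip.add_left, hip.add_right, hH₁, hRH₁]; ring
    · show ip (O₁.Pp x + O₁.Pm x) y = -ip x (O₁.Pp y + O₁.Pm y)
      simp only [Ops.Pp_apply, Ops.Pm_apply, hip.add_left, hip.add_right, hE₁, hF₁, hRE₁, hRF₁]
      ring
    · show ip (I • (O₁.Pp x - O₁.Pm x)) y = -ip x (I • (O₁.Pp y - O₁.Pm y))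
      simp only [Ops.Pp_apply, Ops.Pm_apply, hip.smul_left, hip.smul_right, hip.sub_left,
    hip.sub_right, hip.add_left, hip.add_right, hE₁, hF₁, hRE₁, hRF₁, Complex.conj_I]
      ring
  · intro i x y
    fin_cases i
    · show ip (O₂.P0 x) y = ip x (O₂.P0 y)
      simp only [Ops.P0_apply, hip.add_left, hip.add_right, hLH₂, hRH₂]
    · show ip (O₂.Pp x + O₂.Pm x) y = ip x (O₂.Pp y + O₂.Pm y)
      simp only [Ops.Pp_apply, Ops.Pm_apply, hip.add_left, hip.add_right, hLE₂, hLF₂, hRE₂, hRF₂]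
      ring
    · show ip (I • (O₂.Pp x - O₂.Pm x)) y = ip x (I • (O₂.Pp y - O₂.Pm y))
      simp only [Ops.Pp_apply, Ops.Pm_apply, hip.smul_left, hip.smul_right, hip.sub_left,
    hip.sub_right, hip.add_left, hip.add_right, hLE₂, hLF₂, hRE₂, hRF₂, Complex.conj_I]
      ring

/-- **The Eichler–Shimura–Harder cochain is closed and co-closed** (Kuga's lemma): with
`O = O₁ + O₂` lawful commuting families with the same `Ω_L + Ω_R`, a positive form of unitary type
for `O₁` and compact type for `O₂`, and `y` a diagonal-`𝔨`-highest-weight vector of weight `2`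
with `F_k³ y = 0`: `D_i η_j = D_j η_i` and `δη = 0` for `η = eshCochain (O₁ + O₂) y`.
[cite: BorelWallach2000, II Prop. 2.5] [cite: MatsushimaMurakami1963, §6] [cite: Harder1987, §3.1] -/
theorem eshCochain_closed_coclosed (h₁ : O₁.IsLawful) (h₂ : O₂.IsLawful) (hc : O₁.CommutesWith O₂)
    (hcas : ∀ v, O₁.casL v + O₁.casR v = O₂.casL v + O₂.casR v) (hip : Kuga.IsPosForm ip)
    (hE₁ : ∀ x y, ip (O₁.LE x) y = -ip x (O₁.RE y)) (hF₁ : ∀ x y, ip (O₁.LF x) y = -ip x (O₁.RF y))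
    (hH₁ : ∀ x y, ip (O₁.LH x) y = -ip x (O₁.RH y))
    (hLE₂ : ∀ x y, ip (O₂.LE x) y = ip x (O₂.LF y)) (hLH₂ : ∀ x y, ip (O₂.LH x) y = ip x (O₂.LH y))
    (hRE₂ : ∀ x y, ip (O₂.RE x) y = ip x (O₂.RF y)) (hRH₂ : ∀ x y, ip (O₂.RH x) y = ip x (O₂.RH y))
    {y : M} (hE : (O₁.add O₂).Ek y = 0) (hH : (O₁.add O₂).Hk y = (2 : ℂ) • y)
    (hF3 : (O₁.add O₂).Fk ((O₁.add O₂).Fk ((O₁.add O₂).Fk y)) = 0) :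
    (∀ i j, (setup O₁ O₂).D i (eshCochain (O₁.add O₂) y j) =
      (setup O₁ O₂).D j (eshCochain (O₁.add O₂) y i)) ∧
    (setup O₁ O₂).deltaOne (eshCochain (O₁.add O₂) y) = 0 := by
  have hS := isLawful_setup h₁ h₂ hc hcas
  have hO := Ops.isLawful_add h₁ h₂ hc
  have hη := isCochain_eshCochain hO rfl hE hH hF3
  obtain ⟨hπ, hρ⟩ := skew_and_symm hip hE₁ hF₁ hH₁ hLE₂ hLH₂ hRE₂ hRH₂
  exact ⟨fun i j => Kuga.Setup.closed_of_posForm hS hip hπ hρ hη i j,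
    Kuga.Setup.coclosed_of_posForm hS hip hπ hρ hη⟩

end Kuga

end GL2CKType

end Literature.NumberTheory.Automorphic

end
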